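import Mathlib
import Literature.Geometry.Lorentzian.ReggeWheelerTortoise
import Literature.Geometry.Lorentzian.ReggeWheelerChannels

/-!
# Sketch — crux-ideate K1R (`UniformPhotonSphereChannelsR`, stmt-FinalStateConjecture-14074), ideator 1

First checkable statements ("First lemma") of the three levers filed as crux idea cards:

* (A) `crum-peeling-recessive-tower` — `DarbouxIntertwineRiccati`, `DarbouxDensityIdentity`,
  `OneStepFarDeficitIdentity`;
* (B) `wedge-identity-null-hardy` — `WedgeIdentity`, `NullRayHardy`;
* (C) `kronecker-aak-residual-phase` — `flatJost_isSol`, `FarRadiationField`.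

Everything is stated over `Literature.Geometry.Lorentzian.ReggeWheeler.*` and Mathlib; nothing is
proved here (Props only), the file must merely elaborate.
-/

noncomputable section

open Filter Set MeasureTheory
open scoped ENNReal Topology BigOperators

namespace Summit.FinalStateConjecture.FinalStateConjecture.Cruxes.UniformPhotonSphereChannelsR.Sketch

open Literature.Geometry.Lorentzian.ReggeWheeler

/-! ## (A) Recessive Darboux / confluent Crum peeling -/

/-- **General Darboux intertwining** (Riccati form, generalising the tree's
`Literature.Analysis.PDE.wave1D_intertwine` from `ι' = −ι²` to an arbitrary superpotential):
if `W' + W² = V` on an open set `S` then `A = ∂ₓ − W` maps `C³` solutions of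
`φ_tt = φ_xx − V φ` (on `S`) to `C²` solutions of `ψ_tt = ψ_xx − V₁ ψ` with the partner potential
`V₁ = W² − W' = 2W² − V`.  With `W = u₀'/u₀` for the RECESSIVE zero-energy solution `u₀` of `V`
this is one rung of the peeling ladder. -/
def DarbouxIntertwineRiccati : Prop :=
  ∀ (φ : ℝ → ℝ → ℝ) (W V : ℝ → ℝ) (S : Set ℝ), ContDiff ℝ 3 (Function.uncurry φ) →
    ContDiff ℝ 2 W → IsOpen S → (∀ x ∈ S, deriv W x + W x ^ 2 = V x) →
    (∀ t, ∀ x ∈ S, iteratedDeriv 2 (fun τ => φ τ x) t = iteratedDeriv 2 (φ t) x - V x * φ t x) →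
    ∃ ψ : ℝ → ℝ → ℝ, (∀ t x, ψ t x = deriv (φ t) x - W x * φ t x) ∧
      ContDiff ℝ 2 (Function.uncurry ψ) ∧
      ∀ t, ∀ x ∈ S, iteratedDeriv 2 (fun τ => ψ τ x) t
        = iteratedDeriv 2 (ψ t) x - (W x ^ 2 - deriv W x) * ψ t x

/-- **Pointwise energy-density identity behind the one-step isometry**:
`φₓ² + V φ² = (φₓ − Wφ)² + (W φ²)'` wherever `W' + W² = V`.  Integrated over `x > x_e` it gives
`E_V[φ; x > x_e] = ∫ (φ_t² + (Aφ)²) − W(x_e) φ(x_e)²` (with `W(x_e) ≈ −λ/x_e < 0` on the far side):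
the `V`-energy is the free energy of `(φ_t, Aφ)` plus a nonnegative EDGE term. -/
def DarbouxDensityIdentity : Prop :=
  ∀ (V W : ℝ → ℝ) (φ : ℝ → ℝ → ℝ) (t x : ℝ), DifferentiableAt ℝ W x →
    DifferentiableAt ℝ (φ t) x → deriv W x + W x ^ 2 = V x →
    deriv (φ t) x ^ 2 + V x * φ t x ^ 2
      = (deriv (φ t) x - W x * φ t x) ^ 2 + deriv (fun y => W y * φ t y ^ 2) x

/-- **One-step far deficit identity** (the first genuine lemma of line (A)).  Data: a potential `V`,
a superpotential `W` with `W' + W² = V` on `(x_e, ∞)`, its seed `u₀` (`u₀' = W u₀`, so `u₀'' = V u₀`: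
a static solution), a global `C³` solution `ψ` of the `V`-equation and a `C³` TIME PRIMITIVE `χ`
(`∂ₜχ = ψ`, `χ` again a solution).  Put `ψ̃ = ∂ₓχ − Wχ` (a solution of the partner equation by
`DarbouxIntertwineRiccati`).  Then the far exterior energy of `ψ − c u₀` at `t = 0`, minimised
over the multiple `c` of the seed, equals the partner far energy of `ψ̃` plus the edge term
`|W(x_e)| ψ̃(0,x_e)²`; and the far channel energies of `ψ` and `ψ̃` coincide.  Iterated along the
recessive Jordan chain this kills the `(ℓ+1)`-dimensional tower of K1R exactly ("peeling"). -/
def OneStepFarDeficitIdentity : Prop :=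
  ∀ (V W u₀ : ℝ → ℝ) (xe : ℝ) (ψ χ : ℝ → ℝ → ℝ),
    ContDiff ℝ 2 W → (∀ x, xe < x → deriv W x + W x ^ 2 = V x) → W xe < 0 →
    (∀ x, HasDerivAt u₀ (W x * u₀ x) x) → (∀ x, xe ≤ x → 0 < u₀ x) →
    ContDiff ℝ 3 (Function.uncurry ψ) → IsSolution V ψ →
    ContDiff ℝ 3 (Function.uncurry χ) → IsSolution V χ →
    (∀ t x, deriv (fun τ => χ τ x) t = ψ t x) →
    farEnergy V xe ψ 0 ≠ ⊤ →
    let V₁ : ℝ → ℝ := fun x => W x ^ 2 - deriv W x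
    let ψt : ℝ → ℝ → ℝ := fun t x => deriv (χ t) x - W x * χ t x
    (⨅ c : ℝ, ∫⁻ x in Ioi xe,
        ENNReal.ofReal (energyDensity V (fun t y => ψ t y - c * u₀ y) 0 x))
        = (∫⁻ x in Ioi xe, ENNReal.ofReal (energyDensity V₁ ψt 0 x))
          + ENNReal.ofReal (|W xe| * ψt 0 xe ^ 2) ∧
      farChannelEnergy V xe ψ atTop = farChannelEnergy V₁ xe ψt atTop ∧
      farChannelEnergy V xe ψ atBot = farChannelEnergy V₁ xe ψt atBot

/-! ## (B) The wedge identity and Hardy on the null rays -/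

/-- **The wedge identity** (exact, physical space).  For `ψ_tt − ψ_xx + Vψ = 0` with `V ≥ 0`
non-increasing on `[x_e, ∞)` and finite far energy at `t = 0`:
`E⁺_far + E⁻_far + ∫_{C⁺ ∪ C⁻} V φ² dt = E_far(0) + ½ ∫∫_{Ω_f} (−V') ψ²`,
where `C⁺ = {(t, x_e + t), t > 0}`, `C⁻ = {(t, x_e − t), t < 0}` are the two null rays from the edge
point, `φ` the trace of `ψ` on them, and `Ω_f = {x > x_e + |t|}` the far cone.  (From
`dE_far/dt = −(φ̇² + Vφ²)` on the rays and the SIDEWAYS identity for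
`X ↦ ∫_{|t|<X−x_e} (ψ_x² + ψ_t² − Vψ²)(t, X) dt`, whose limit as `X → ∞` is `E⁺ + E⁻`.) -/
def WedgeIdentity : Prop :=
  ∀ (V : ℝ → ℝ) (xe : ℝ) (ψ : ℝ → ℝ → ℝ), ContDiff ℝ 1 V → (∀ x, xe ≤ x → 0 ≤ V x) →
    AntitoneOn V (Ici xe) → IsSolution V ψ → farEnergy V xe ψ 0 ≠ ⊤ →
    farChannelEnergy V xe ψ atTop + farChannelEnergy V xe ψ atBot
        + (∫⁻ t in Ioi (0 : ℝ), ENNReal.ofReal (V (xe + t) * ψ t (xe + t) ^ 2))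
        + (∫⁻ t in Iio (0 : ℝ), ENNReal.ofReal (V (xe - t) * ψ t (xe - t) ^ 2))
      = farEnergy V xe ψ 0
        + ∫⁻ z in {z : ℝ × ℝ | xe + |z.1| < z.2},
            ENNReal.ofReal (-(1 / 2) * deriv V z.2 * ψ z.1 z.2 ^ 2)

/-- **Hardy on a null ray with vanishing corner value** (the closing estimate for a SMALL peeled
potential): along `C⁺`, `∫₀^∞ Q(x_e+t) φ(t)² dt ≤ 4 · sup_{t>0} (t² Q(x_e+t)) · ∫₀^∞ φ̇(t)² dt` for
`φ(0) = 0` (one kills the corner value with the single remaining static mode), and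
`∫ φ̇² ≤ LOST⁺ ≤ E_far(0)`.  Stated for a `C¹` function on `[0, ∞)`. -/
def NullRayHardy : Prop :=
  ∀ (Q : ℝ → ℝ) (φ : ℝ → ℝ) (K : ℝ), 0 ≤ K → (∀ t, 0 < t → 0 ≤ Q t ∧ t ^ 2 * Q t ≤ K) →
    ContDiff ℝ 1 φ → φ 0 = 0 →
    (∫⁻ t in Ioi (0 : ℝ), ENNReal.ofReal (Q t * φ t ^ 2))
      ≤ ENNReal.ofReal (4 * K) * ∫⁻ t in Ioi (0 : ℝ), ENNReal.ofReal (deriv φ t ^ 2)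

/-! ## (C) Kronecker–AAK: finite rank from polynomiality of the Jost solution -/

/-- The flat outgoing Jost (Riccati–Hankel) solution of `−u'' + ℓ(ℓ+1)x⁻² u = k² u`:
`u(x) = e^{ikx} Σ_{j ≤ ℓ} (ℓ+j)!/(j!(ℓ−j)!) · (i/(2kx))ʲ` — exponential times a POLYNOMIAL in
`1/(kx)` of degree `ℓ` (the algebraic fact behind "the flat lost operator has finite rank = tower
dimension", Kronecker-style). -/
def flatJost (ℓ : ℕ) (k : ℝ) (x : ℝ) : ℂ :=
  Complex.exp (Complex.I * k * x) *
    ∑ j ∈ Finset.range (ℓ + 1),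
      ((Nat.factorial (ℓ + j) : ℂ) / ((Nat.factorial j : ℂ) * (Nat.factorial (ℓ - j) : ℂ))) *
        (Complex.I / (2 * (k : ℂ) * (x : ℂ))) ^ j

/-- **First lemma of line (C)**: `flatJost ℓ k` solves the frequency-`k` centrifugal equation on
`x ≠ 0` (checked by hand for `ℓ = 1` in NOTES.md).  Its RW analogue (far Jost solution of
`V_{s,ℓ}`) is `e^{ikx} × (polynomial part) × (Coulomb-log phase residual u_ℓ(k,x))`; the line bounds
the Nehari/AAK distance of that residual from `H^∞ + R_n`. -/
def flatJost_isSol : Prop :=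
  ∀ (ℓ : ℕ) (k x : ℝ), k ≠ 0 → x ≠ 0 →
    -(deriv (deriv (flatJost ℓ k)) x) + ((ℓ : ℂ) * ((ℓ : ℂ) + 1) / (x : ℂ) ^ 2) * flatJost ℓ k x
      = ((k : ℂ) ^ 2) * flatJost ℓ k x

/-- **Far radiation field with sharp cone localisation** (the translation representation at the
`𝓘` end, the object on which the Hankel/Toeplitz structure of line (C) lives): every finite-energy
Regge–Wheeler solution has an outgoing profile `G ∈ L²` with
`E⁺_far(x_e) = 2 ∫_{u > x_e} G(u)² du` for every edge `x_e` beyond the photon sphere, and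
`(ψ_t + G(x−t), ψ_x − G(x−t)) → 0` in `L²` of the far half. -/
def FarRadiationField : Prop :=
  ∀ (M : ℝ), 0 < M → ∀ (r : ℝ → ℝ) (xc : ℝ), IsTortoiseRadius M r xc → ∀ (s ℓ : ℕ), s ≤ 2 → s ≤ ℓ →
    ∀ ψ : ℝ → ℝ → ℝ, IsRWSolution M s ℓ r ψ → totalEnergy (linePotential M s ℓ r) ψ 0 ≠ ⊤ →
      ∃ G : ℝ → ℝ, MemLp G 2 volume ∧
        (∀ xe : ℝ, xc < xe →
          farChannelEnergy (linePotential M s ℓ r) xe ψ atTop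
            = ENNReal.ofReal (2 * ∫ u in Ioi xe, G u ^ 2)) ∧
        Tendsto (fun t : ℝ => ∫ x in Ioi (xc + t / 2),
            (deriv (fun τ => ψ τ x) t + G (x - t)) ^ 2 + (deriv (ψ t) x - G (x - t)) ^ 2)
          atTop (𝓝 0)

/-! ## Typing sanity: the crux body over the vocabulary (copied from the route file, rev 10) -/

/-- The crux K1R as typed in the route file (for reference; `Iff.rfl` with the route decl). -/
def K1R : Prop :=
  ∀ M : ℝ, 0 < M → ∃ ρ₀ : ℝ, 0 ≤ ρ₀ ∧ ∃ C : ℝ, 0 ≤ C ∧ ∃ c : ℝ, 0 < c ∧ ∀ (r : ℝ → ℝ) (xc : ℝ),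
    IsTortoiseRadius M r xc → ∀ (s ℓ : ℕ), s ≤ 2 → s ≤ ℓ → ∀ ρ : ℝ,
      ρ₀ + C * Real.log ((ℓ : ℝ) + 1) ≤ ρ →
        ChannelInequality (linePotential M s ℓ r) xc ρ c

/-- The FAR log-edge half (the open content of K1R after `Theorems.nearHalfLineChannels` and
`Theorems.fixedModeChannels_of_near_far`), in the one-ended vocabulary: edge `x_e = x_c + ρ`,
kernel = `C²` solutions t-polynomial on the far cone `{x_c + ρ + |t| < x}`. All three levers attack
THIS statement. -/
def FarLogEdgeChannels : Prop :=
  ∀ M : ℝ, 0 < M → ∃ ρ₀ : ℝ, 0 ≤ ρ₀ ∧ ∃ C : ℝ, 0 ≤ C ∧ ∃ c : ℝ, 0 < c ∧ ∀ (r : ℝ → ℝ) (xc : ℝ),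
    IsTortoiseRadius M r xc → ∀ (s ℓ : ℕ), s ≤ 2 → s ≤ ℓ → ∀ ρ : ℝ,
      ρ₀ + C * Real.log ((ℓ : ℝ) + 1) ≤ ρ → ∀ ψ : ℝ → ℝ → ℝ, IsRWSolution M s ℓ r ψ →
        let V := linePotential M s ℓ r
        let Ω : Set (ℝ × ℝ) := {z | xc + ρ + |z.1| < z.2}
        let P : Set (ℝ → ℝ → ℝ) := {p | IsSolutionOn V p Ω ∧ IsPolynomialInTimeOn p Ω}
        ENNReal.ofReal c * (⨅ p ∈ P, ∫⁻ x in Ioi (xc + ρ),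
            ENNReal.ofReal (energyDensity V (fun t y => ψ t y - p t y) 0 x))
          ≤ farChannelEnergy V (xc + ρ) ψ atTop + farChannelEnergy V (xc + ρ) ψ atBot

end Summit.FinalStateConjecture.FinalStateConjecture.Cruxes.UniformPhotonSphereChannelsR.Sketch
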